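import Summits.BirchSwinnertonDyer.BirchSwinnertonDyer.Theorems.GenusKolyvaginAtTwoMinimalTwinBSDTwoKrizLiAnchor141d1RootNumber
import HarnessLib

/-!
# Route `GenusKolyvaginAtTwo`, crux U₂ `MinimalTwinBSDTwo` (stmt-BirchSwinnertonDyer-22985), LINE 23 «twin_swap»: THE ROAD THEOREMS OF `…KrizLiAnchor141d1.lean` WITH THE
# Gross–Zagier–Kolyvagin INPUT DISCHARGED — `r_an(141d1) = 1` from the kernel root number `w(141d1) = −1` (`…KrizLiAnchor141d1RootNumber.lean`, `analyticRank_141D1_of_modularity`)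
# modulo the Modularity Theorem (`exists_isNewformOf`) + Kriz–Li Thm 4.3, in place of `rank_eq_analyticRank_of_analyticRank_le_one`

Seat `bsd-line-gk2-p2` g36 (PROVER 2/3, cell `bsd-f1-sign2`; LINE 23 holder), `--supports stmt-BirchSwinnertonDyer-22985` (helper; closes nothing).
THEOREMS ONLY (0 `def`, 0 `sorry`); standard axioms.  Each theorem below is the verbatim road theorem of `…KrizLiAnchor141d1.lean` with the binder
`(hGZK : rank_eq_analyticRank_of_analyticRank_le_one)` replaced by `(hmod : exists_isNewformOf)`; the wall rows (`hS1` / `hSS`) and the PRINT facts stay displayed.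
**BSD is NOT proved by any of this; U₂ is NOT proved; no item is closed.**

References: [KrizLi2019] Thm 5.1 (2), Thm 4.3, §6 Table 1 (row 141d1); [CreutzMiller2012] Thm 1.1; [CremonaAlgorithms1997] Table 1 (141D1); [BCDTJAMS2001] Thm. A.
-/

set_option autoImplicit false
-- the Theorems namespace of this sub repeats the summit name by design (D-0017 nested layout)
set_option linter.dupNamespace false

noncomputable section

open scoped Classical NumberField

open WeierstrassCurve IsDedekindDomain Rat.HeightOneSpectrum NumberField Literature.NumberTheory.EllipticCurves
  Literature.NumberTheory.EllipticCurves.ModularForms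
  Literature.NumberTheory.EllipticCurves.Rank1Residual
  Literature.NumberTheory.EllipticCurves.Rank1Residual.Typed
  Literature.NumberTheory.DiophantineGeometry
  Summit.BirchSwinnertonDyer
  Summit.BirchSwinnertonDyer.Rank1Residual
  Summit.BirchSwinnertonDyer.Rank1Residual.X11b
  Summit.BirchSwinnertonDyer.Rank1Residual.X5.O1
  Summit.BirchSwinnertonDyer.Rank1Residual.P2
  Summit.BirchSwinnertonDyer.BirchSwinnertonDyer.Rank1Residual.IntModel
  Summit.BirchSwinnertonDyer.BirchSwinnertonDyer.Theorems
  Summit.BirchSwinnertonDyer.BirchSwinnertonDyer.Theorems.AddPotGoodPrint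
  Summit.BirchSwinnertonDyer.BirchSwinnertonDyer.Theorems.GenusExact.TwinSwap.KrizLiAnchorWall

namespace Summit.BirchSwinnertonDyer.BirchSwinnertonDyer.Theorems.GenusExact.TwinSwap.KrizLiAnchor141d1

/-! ## §4 The road theorems of `…KrizLiAnchor141d1.lean` with GZK DISCHARGED (`hmod` in place of `hGZK`) -/
section Roads141D1OfModularity

/-- (GZK DISCHARGED: `hmod` = the Modularity Theorem `exists_isNewformOf` replaces `hGZK`; `r_an = 1` from the root number.) ★ **`BSD(W′, 2)` at EVERY global minimal `W′ ≅ 141d1^{(d)}` or `≅ 141d1^{(-23d)}`**, `d ∈ 𝒩(141d1, K)`, `χ_d(−141) = 1`, from the Table-1 row, PRINT, and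
the WALL (S1′ displayed as `hS1`: `BSD₂` for every non-CM curve of analytic rank `0`).  [cite: KrizLi2019, Thm. 5.1 (2), Thm. 4.3, §6 Table 1 (row 141d1)]
[cite: CreutzMiller2012, Thm. 1.1] [cite: Miller2011LMS, Def. 1.1] -/
theorem krizLi_bsdp_two_of_twist_141D1_of_wall_of_modularity (hKL : KrizLi2019.thm112_bsdTwo_twist) (h33 : KrizLi2019.thm33_rank_twist)
    (htab : KrizLi2019.table1_row141d1) (hS31 : bsdTriple_of_analyticRank_le_one_of_conductor_lt)
    (hmod : exists_isNewformOf)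
    (hS1 : ∀ (W : WeierstrassCurve ℚ) [W.IsElliptic] [W.IsGloballyMinimal], ¬ W.HasCM → W.analyticRank = 0 → BSDp W 2)
    (K : Type) [Field K] [NumberField K] (hK : IsImaginaryQuadratic K) (hdK : NumberField.discr K = -23)
    {d : ℤ} (hd : haveI := isGloballyMinimal_141D1; KrizLi2019.InN (⟨0, -1, 1, -1, 0⟩ : WeierstrassCurve ℚ) K d)
    (hsign : haveI := isElliptic_141D1; Int.sign d * jacobiSym ((⟨0, -1, 1, -1, 0⟩ : WeierstrassCurve ℚ).conductorNorm ℤ) d.natAbs = 1)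
    (W' : WeierstrassCurve ℚ) [W'.IsElliptic] [W'.IsGloballyMinimal]
    (hW' : (∃ C : VariableChange ℚ, C • (⟨0, -1, 1, -1, 0⟩ : WeierstrassCurve ℚ).quadraticTwist (d : ℚ) = W') ∨
      (∃ C : VariableChange ℚ, C • (⟨0, -1, 1, -1, 0⟩ : WeierstrassCurve ℚ).quadraticTwist ((d * NumberField.discr K : ℤ) : ℚ) = W')) :
    BSDp W' 2 := by
  haveI := isElliptic_141D1; haveI := isGloballyMinimal_141D1
  obtain ⟨_, Dt, H, ι, P, j, -, hP, hstar⟩ := htab K hK hdK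
  exact krizLi_bsdp_two_of_twist_of_conductor_lt_of_wall _ hKL h33 hS31 hS1 conductorNorm_lt_5000_141D1 not_hasCM_141D1
    (analyticRank_141D1_of_modularity h33 htab hmod) twoTorsion_141D1 K hK (satisfiesHeegnerHypothesis_141D1 hK.1 hdK) Dt H ι P hP j hstar (krizLi_loc_141D1 Dt)
    hd hsign W' hW'

/-- (GZK DISCHARGED: `hmod` = the Modularity Theorem `exists_isNewformOf` replaces `hGZK`; `r_an = 1` from the root number.) **THE RANK-ONE MEMBERS `141d1^{(d)}` — U₂-CLASS CURVES SETTLED MODULO THE WALL + PRINT**: at every global minimal `W₁ ≅ 141d1^{(d)}` (`d ∈ 𝒩(141d1, K)`,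
`χ_d(−141) = 1`): `r_an(W₁) = 1 ∧ ¬CM ∧ BSD(W₁, 2)`.  BSD is not proved by any of this; U₂ is not proved.
[cite: KrizLi2019, Thm. 5.1 (2), Thm. 4.3, Thm. 1.4, §6 Table 1 (row 141d1)] [cite: CreutzMiller2012, Thm. 1.1] -/
theorem rankOneMembers_141D1_of_modularity (hKL : KrizLi2019.thm112_bsdTwo_twist) (h33 : KrizLi2019.thm33_rank_twist)
    (htab : KrizLi2019.table1_row141d1) (hS31 : bsdTriple_of_analyticRank_le_one_of_conductor_lt)
    (hmod : exists_isNewformOf)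
    (hS1 : ∀ (W : WeierstrassCurve ℚ) [W.IsElliptic] [W.IsGloballyMinimal], ¬ W.HasCM → W.analyticRank = 0 → BSDp W 2)
    (K : Type) [Field K] [NumberField K] (hK : IsImaginaryQuadratic K) (hdK : NumberField.discr K = -23)
    {d : ℤ} (hd : haveI := isGloballyMinimal_141D1; KrizLi2019.InN (⟨0, -1, 1, -1, 0⟩ : WeierstrassCurve ℚ) K d)
    (hsign : haveI := isElliptic_141D1; Int.sign d * jacobiSym ((⟨0, -1, 1, -1, 0⟩ : WeierstrassCurve ℚ).conductorNorm ℤ) d.natAbs = 1)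
    (W₁ : WeierstrassCurve ℚ) [W₁.IsElliptic] [W₁.IsGloballyMinimal]
    (hW₁ : ∃ C : VariableChange ℚ, C • (⟨0, -1, 1, -1, 0⟩ : WeierstrassCurve ℚ).quadraticTwist (d : ℚ) = W₁) :
    W₁.analyticRank = 1 ∧ ¬ W₁.HasCM ∧ BSDp W₁ 2 := by
  haveI := isElliptic_141D1; haveI := isGloballyMinimal_141D1
  obtain ⟨_, Dt, H, ι, P, j, -, hP, hstar⟩ := htab K hK hdK
  exact rankOneMembers_of_wall _ hKL h33 hS31 hS1 conductorNorm_lt_5000_141D1 not_hasCM_141D1 (analyticRank_141D1_of_modularity h33 htab hmod) twoTorsion_141D1 K hK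
    (satisfiesHeegnerHypothesis_141D1 hK.1 hdK) Dt H ι P hP j hstar (krizLi_loc_141D1 Dt) hd hsign W₁ hW₁

/-- (GZK DISCHARGED: `hmod` = the Modularity Theorem `exists_isNewformOf` replaces `hGZK`; `r_an = 1` from the root number.) **THE RANK-ZERO COMPANIONS `141d1^{(-23d)}` — WALL ROW-1 INSTANCES**: at every global minimal `W₂ ≅ 141d1^{(d·d_K)}` (`d ∈ 𝒩(141d1, K)`, `χ_d(−141) = 1`):
`r_an(W₂) = 0 ∧ ¬CM ∧ BSD(W₂, 2)` (the last granted the wall).  BSD is not proved by any of this.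
[cite: KrizLi2019, Thm. 5.1 (2), Thm. 4.3, §6 Table 1 (row 141d1)] [cite: CreutzMiller2012, Thm. 1.1] -/
theorem rankZeroCompanions_141D1_of_modularity (hKL : KrizLi2019.thm112_bsdTwo_twist) (h33 : KrizLi2019.thm33_rank_twist)
    (htab : KrizLi2019.table1_row141d1) (hS31 : bsdTriple_of_analyticRank_le_one_of_conductor_lt)
    (hmod : exists_isNewformOf)
    (hS1 : ∀ (W : WeierstrassCurve ℚ) [W.IsElliptic] [W.IsGloballyMinimal], ¬ W.HasCM → W.analyticRank = 0 → BSDp W 2)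
    (K : Type) [Field K] [NumberField K] (hK : IsImaginaryQuadratic K) (hdK : NumberField.discr K = -23)
    {d : ℤ} (hd : haveI := isGloballyMinimal_141D1; KrizLi2019.InN (⟨0, -1, 1, -1, 0⟩ : WeierstrassCurve ℚ) K d)
    (hsign : haveI := isElliptic_141D1; Int.sign d * jacobiSym ((⟨0, -1, 1, -1, 0⟩ : WeierstrassCurve ℚ).conductorNorm ℤ) d.natAbs = 1)
    (W₂ : WeierstrassCurve ℚ) [W₂.IsElliptic] [W₂.IsGloballyMinimal]
    (hW₂ : ∃ C : VariableChange ℚ, C • (⟨0, -1, 1, -1, 0⟩ : WeierstrassCurve ℚ).quadraticTwist ((d * NumberField.discr K : ℤ) : ℚ) = W₂) :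
    W₂.analyticRank = 0 ∧ ¬ W₂.HasCM ∧ BSDp W₂ 2 := by
  haveI := isElliptic_141D1; haveI := isGloballyMinimal_141D1
  obtain ⟨_, Dt, H, ι, P, j, -, hP, hstar⟩ := htab K hK hdK
  exact rankZeroCompanions_of_wall _ hKL h33 hS31 hS1 conductorNorm_lt_5000_141D1 not_hasCM_141D1 (analyticRank_141D1_of_modularity h33 htab hmod) twoTorsion_141D1 K hK
    (satisfiesHeegnerHypothesis_141D1 hK.1 hdK) Dt H ι P hP j hstar (krizLi_loc_141D1 Dt) hd hsign W₂ hW₂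

/-- (GZK DISCHARGED: `hmod` = the Modularity Theorem `exists_isNewformOf` replaces `hGZK`; `r_an = 1` from the root number.) **The rank-one member `141d1^{(29)}`** (`N = 118581`): `r_an = 1 ∧ ¬CM ∧ BSD(·, 2)` at every global minimal model, modulo the WALL + PRINT — the
`141d1` road is not vacuous on the U₂ side. BSD is not proved by any of this. [cite: KrizLi2019, Thm. 5.1 (2), Thm. 4.3, §6 Table 1 (row 141d1)] [cite: CreutzMiller2012, Thm. 1.1] -/
theorem rankOneMember_witness_141D1_of_modularity (hKL : KrizLi2019.thm112_bsdTwo_twist) (h33 : KrizLi2019.thm33_rank_twist)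
    (htab : KrizLi2019.table1_row141d1) (hS31 : bsdTriple_of_analyticRank_le_one_of_conductor_lt)
    (hmod : exists_isNewformOf)
    (hS1 : ∀ (W : WeierstrassCurve ℚ) [W.IsElliptic] [W.IsGloballyMinimal], ¬ W.HasCM → W.analyticRank = 0 → BSDp W 2)
    (K : Type) [Field K] [NumberField K] (hK : IsImaginaryQuadratic K) (hdK : NumberField.discr K = -23)
    (W₁ : WeierstrassCurve ℚ) [W₁.IsElliptic] [W₁.IsGloballyMinimal]
    (hW₁ : ∃ C : VariableChange ℚ, C • (⟨0, -1, 1, -1, 0⟩ : WeierstrassCurve ℚ).quadraticTwist ((29 : ℤ) : ℚ) = W₁) :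
    W₁.analyticRank = 1 ∧ ¬ W₁.HasCM ∧ BSDp W₁ 2 :=
  rankOneMembers_141D1_of_modularity hKL h33 htab hS31 hmod hS1 K hK hdK (inN_witness_141D1 hK.1 hdK) sign_witness_141D1 W₁ hW₁

end Roads141D1OfModularity

end Summit.BirchSwinnertonDyer.BirchSwinnertonDyer.Theorems.GenusExact.TwinSwap.KrizLiAnchor141d1

end
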